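import Summits.AtomisticToContinuum.BoseEinsteinCondensation.Theorems.BECCutLineWeakDisorderWitnessTransferShellPotentialAux
import HarnessLib

/-!
# Route BECCutLineWeakDisorder — crux `WitnessTransfer`, line `Sketch`: stub (S7)
`stub_lintegral_radial_mul_inv_norm_sub_le` (Newton's shell theorem as an inequality)

Registered stub (S7) of line `Sketch` (crux item stmt-AtomisticToContinuum-14978): for a radial
density `g(‖w‖) ≥ 0` on `Space = ℝ³`,
`∫ g(‖w‖) ‖w − x‖⁻¹ dw ≤ ∫ g(‖w‖) ‖w‖⁻¹ dw` for a.e. `x` — the Newtonian potential of a radial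
charge is maximal at the centre (Newton's shell theorem: the potential of the spherical shell of
radius `r` is `mass / max(r, ‖x‖)`).

Proof.  Fix `x ≠ 0`, `s = ‖x‖`.  The two measures `‖w − x‖⁻¹ dw` and `(max(‖w‖, s))⁻¹ dw` on
`ℝ³` give the same mass to every ball `B(0, a)`:
* for `a < s` this is Newton's theorem for exterior points
  (`setLIntegral_ball_inv_norm_sub`, file `…ShellPotentialAux`), for `a = s` by exhaustion
  with rational radii;
* for `a > s`, `B(0,a) = B̄(0,s) ∪ {s < ‖w‖ < a}`, spheres are Lebesgue-null, and the shell
  `{s < ‖w‖ < a}` is exhausted by the shells `{q < ‖w‖ < r}` with rational `s < q`, `r < a`, on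
  which the identity `∫ ‖w − x‖⁻¹ = ∫ ‖w‖⁻¹` is Newton's theorem for interior points — available
  for a.e. `x` simultaneously for all rational shells (`shellPotential_ae_eq`).
The balls `B(0,a) = {‖w‖ < a}` generate the radial σ-algebra, so the image measures under
`w ↦ ‖w‖` coincide (`map_norm_eq_of_forall_ball`, π-λ), whence
`∫ g(‖w‖) ‖w − x‖⁻¹ dw = ∫ g(‖w‖) (max(‖w‖, s))⁻¹ dw ≤ ∫ g(‖w‖) ‖w‖⁻¹ dw`.

References: O. D. Kellogg, *Foundations of Potential Theory*, Ch. III §3; E. H. Lieb, M. Loss,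
*Analysis*, Thm 9.7.
-/

noncomputable section

open MeasureTheory ProbabilityTheory Filter Set Metric
open scoped ENNReal NNReal Topology

namespace Summit.AtomisticToContinuum.BoseEinsteinCondensation.Theorems.CutLineWitness

open Literature.MathematicalPhysics.QuantumManyBody.BoseGas
open Literature.Probability.Process

/-! ### Exhaustion of balls and shells by rational ones -/

/-- `B(0,s) = ⋃_{q ∈ ℚ, q < s} B(0,q)` is a directed countable union, so
`ν(B(0,s)) = sup_q ν(B(0,q))` for every measure `ν` on `ℝ³`. [folklore] -/
theorem measure_ball_eq_iSup_rat (ν : Measure Space) (s : ℝ) :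
    ν (ball 0 s) = ⨆ q : {q : ℚ // (q : ℝ) < s}, ν (ball 0 q) := by
  have hdir : Directed (· ⊆ ·) fun q : {q : ℚ // (q : ℝ) < s} => ball (0 : Space) q := by
    refine Monotone.directed_le fun q q' hqq' => ball_subset_ball ?_
    exact_mod_cast hqq'
  have hU : ball (0 : Space) s = ⋃ q : {q : ℚ // (q : ℝ) < s}, ball (0 : Space) q := by
    refine subset_antisymm (fun w hw => ?_) (iUnion_subset fun q => ball_subset_ball q.2.le)
    obtain ⟨q, hwq, hqs⟩ := exists_rat_btwn (mem_ball_zero_iff.1 hw)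
    exact mem_iUnion.2 ⟨⟨q, hqs⟩, mem_ball_zero_iff.2 hwq⟩
  rw [hU, hdir.measure_iUnion]

/-- `{s < ‖w‖ < a} = ⋃ {q < ‖w‖ < r}` over rational `s < q`, `r < a` is a directed countable
union, so `ν{s < ‖w‖ < a} = sup ν{q < ‖w‖ < r}` for every measure `ν` on `ℝ³`. [folklore] -/
theorem measure_shell_eq_iSup_rat (ν : Measure Space) (s a : ℝ) :
    ν ((fun w : Space => ‖w‖) ⁻¹' Ioo s a) =
      ⨆ p : {p : ℚ × ℚ // s < p.1 ∧ (p.2 : ℝ) < a},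
        ν ((fun w : Space => ‖w‖) ⁻¹' Ioo (p.1.1 : ℝ) p.1.2) := by
  have hdir : Directed (· ⊆ ·) fun p : {p : ℚ × ℚ // s < p.1 ∧ (p.2 : ℝ) < a} =>
      (fun w : Space => ‖w‖) ⁻¹' Ioo (p.1.1 : ℝ) p.1.2 := by
    rintro ⟨⟨q₁, r₁⟩, h₁, h₁'⟩ ⟨⟨q₂, r₂⟩, h₂, h₂'⟩
    refine ⟨⟨⟨min q₁ q₂, max r₁ r₂⟩, ?_, ?_⟩, ?_, ?_⟩
    · push_cast
      exact lt_min h₁ h₂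
    · push_cast
      exact max_lt h₁' h₂'
    · refine preimage_mono (Ioo_subset_Ioo ?_ ?_) <;> push_cast
      exacts [min_le_left _ _, le_max_left _ _]
    · refine preimage_mono (Ioo_subset_Ioo ?_ ?_) <;> push_cast
      exacts [min_le_right _ _, le_max_right _ _]
  have hU : (fun w : Space => ‖w‖) ⁻¹' Ioo s a =
      ⋃ p : {p : ℚ × ℚ // s < p.1 ∧ (p.2 : ℝ) < a},
        (fun w : Space => ‖w‖) ⁻¹' Ioo (p.1.1 : ℝ) p.1.2 := by
    refine subset_antisymm (fun w hw => ?_)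
      (iUnion_subset fun p => preimage_mono (Ioo_subset_Ioo p.2.1.le p.2.2.le))
    obtain ⟨q, hsq, hqw⟩ := exists_rat_btwn hw.1
    obtain ⟨r, hwr, hra⟩ := exists_rat_btwn hw.2
    exact mem_iUnion.2 ⟨⟨(q, r), hsq, hra⟩, ⟨hqw, hwr⟩⟩
  rw [hU, hdir.measure_iUnion]

/-! ### The two potentials have the same radial marginal -/

/-- Newton's theorem for exterior points, measure form: for `a < ‖x‖` the measures
`‖w − x‖⁻¹ dw` and `(max(‖w‖, ‖x‖))⁻¹ dw` give the ball `B(0,a)` the same mass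
`|B(0,a)| / ‖x‖`. [folklore] -/
theorem withDensity_inv_norm_sub_ball_of_lt (x : Space) {a : ℝ} (ha : a < ‖x‖) :
    (volume.withDensity fun w : Space => ENNReal.ofReal ‖w - x‖⁻¹) (ball 0 a) =
      (volume.withDensity fun w : Space => ENNReal.ofReal (max ‖w‖ ‖x‖)⁻¹) (ball 0 a) := by
  rcases le_or_gt a 0 with ha0 | ha0
  · simp only [Metric.ball_eq_empty.2 ha0, measure_empty]
  rw [withDensity_apply _ measurableSet_ball, withDensity_apply _ measurableSet_ball,
    setLIntegral_ball_inv_norm_sub x ha0 ha]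
  have h : ∀ w ∈ ball (0 : Space) a,
      ENNReal.ofReal (max ‖w‖ ‖x‖)⁻¹ = ENNReal.ofReal ‖x‖⁻¹ := fun w hw => by
    rw [max_eq_right ((mem_ball_zero_iff.1 hw).trans ha).le]
  rw [setLIntegral_congr_fun measurableSet_ball h, setLIntegral_const]

/-- The same at the critical radius `a = ‖x‖`, by exhaustion of `B(0, ‖x‖)` with balls of
rational radii `q < ‖x‖`. [folklore] -/
theorem withDensity_inv_norm_sub_ball_self (x : Space) :
    (volume.withDensity fun w : Space => ENNReal.ofReal ‖w - x‖⁻¹) (ball 0 ‖x‖) =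
      (volume.withDensity fun w : Space => ENNReal.ofReal (max ‖w‖ ‖x‖)⁻¹) (ball 0 ‖x‖) := by
  rw [measure_ball_eq_iSup_rat, measure_ball_eq_iSup_rat]
  exact iSup_congr fun q => withDensity_inv_norm_sub_ball_of_lt x q.2

/-- Measures with a density do not charge spheres, so closed and open balls have the same mass.
[folklore] -/
theorem withDensity_closedBall_eq_ball (f : Space → ℝ≥0∞) (s : ℝ) :
    volume.withDensity f (closedBall (0 : Space) s) = volume.withDensity f (ball 0 s) := by
  have hsph : volume.withDensity f (sphere (0 : Space) s) = 0 :=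
    withDensity_absolutelyContinuous volume f (Measure.addHaar_sphere volume (0 : Space) s)
  refine le_antisymm ?_ (measure_mono ball_subset_closedBall)
  rw [← ball_union_sphere]
  refine (measure_union_le _ _).trans ?_
  rw [hsph, add_zero]

/-- **Same mass on all balls.** If `x` satisfies the interior identity
`∫_{q<‖w‖<r} ‖w − x‖⁻¹ dw = ∫_{q<‖w‖<r} ‖w‖⁻¹ dw` for all rational `q > ‖x‖` and `r`, then the
measures `‖w − x‖⁻¹ dw` and `(max(‖w‖, ‖x‖))⁻¹ dw` agree on every ball `B(0,a)`: for `a ≤ ‖x‖` by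
the two lemmas above; for `a > ‖x‖` decompose `B(0,a) = B̄(0,‖x‖) ∪ {‖x‖ < ‖w‖ < a}` and exhaust
the shell by rational ones. [folklore] -/
theorem withDensity_inv_norm_sub_ball {x : Space}
    (hgood : ∀ q r : ℚ, ‖x‖ < q →
      ∫⁻ w in (fun w : Space => ‖w‖) ⁻¹' Ioo (q : ℝ) r, ENNReal.ofReal ‖w - x‖⁻¹ =
        ∫⁻ w in (fun w : Space => ‖w‖) ⁻¹' Ioo (q : ℝ) r, ENNReal.ofReal ‖w‖⁻¹) (a : ℝ) :
    (volume.withDensity fun w : Space => ENNReal.ofReal ‖w - x‖⁻¹) (ball 0 a) =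
      (volume.withDensity fun w : Space => ENNReal.ofReal (max ‖w‖ ‖x‖)⁻¹) (ball 0 a) := by
  rcases lt_trichotomy a ‖x‖ with ha | rfl | ha
  · exact withDensity_inv_norm_sub_ball_of_lt x ha
  · exact withDensity_inv_norm_sub_ball_self x
  -- `a > ‖x‖`: the shells beyond `‖x‖`
  have hshell : (volume.withDensity fun w : Space => ENNReal.ofReal ‖w - x‖⁻¹)
        ((fun w : Space => ‖w‖) ⁻¹' Ioo ‖x‖ a) =
      (volume.withDensity fun w : Space => ENNReal.ofReal (max ‖w‖ ‖x‖)⁻¹)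
        ((fun w : Space => ‖w‖) ⁻¹' Ioo ‖x‖ a) := by
    rw [measure_shell_eq_iSup_rat, measure_shell_eq_iSup_rat]
    refine iSup_congr fun p => ?_
    have hS : MeasurableSet ((fun w : Space => ‖w‖) ⁻¹' Ioo (p.1.1 : ℝ) p.1.2) :=
      measurable_norm measurableSet_Ioo
    rw [withDensity_apply _ hS, withDensity_apply _ hS, hgood p.1.1 p.1.2 p.2.1]
    refine setLIntegral_congr_fun hS fun w hw => ?_
    rw [max_eq_left (p.2.1.trans hw.1).le]
  -- decomposition of the ball
  have hdec : ball (0 : Space) a = closedBall 0 ‖x‖ ∪ (fun w : Space => ‖w‖) ⁻¹' Ioo ‖x‖ a := by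
    ext w
    simp only [mem_ball_zero_iff, mem_union, mem_closedBall_zero_iff, mem_preimage, mem_Ioo]
    constructor
    · intro h
      rcases le_or_gt ‖w‖ ‖x‖ with h' | h'
      exacts [Or.inl h', Or.inr ⟨h', h⟩]
    · rintro (h | ⟨_, h⟩)
      exacts [h.trans_lt ha, h]
  have hdisj : Disjoint (closedBall (0 : Space) ‖x‖) ((fun w : Space => ‖w‖) ⁻¹' Ioo ‖x‖ a) := by
    rw [Set.disjoint_left]
    intro w hw hw'
    exact absurd (mem_closedBall_zero_iff.1 hw) (not_le.2 hw'.1)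
  have hm : MeasurableSet ((fun w : Space => ‖w‖) ⁻¹' Ioo ‖x‖ a) :=
    measurable_norm measurableSet_Ioo
  rw [hdec, measure_union hdisj hm, measure_union hdisj hm, withDensity_closedBall_eq_ball,
    withDensity_closedBall_eq_ball, withDensity_inv_norm_sub_ball_self x, hshell]

/-- **Balls centred at the origin determine the radial marginal.** Two measures on `ℝ³` that
agree on all balls `B(0,a)` (the first finite on them) have the same image under `w ↦ ‖w‖`: the
rays `(-∞, a) = ‖·‖ (B(0,a))` form a π-system generating the Borel σ-algebra of `ℝ`.
[folklore] -/
theorem map_norm_eq_of_forall_ball {ν₁ ν₂ : Measure Space} (hfin : ∀ n : ℕ, ν₁ (ball 0 n) ≠ ∞)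
    (h : ∀ a : ℝ, ν₁ (ball 0 a) = ν₂ (ball 0 a)) :
    ν₁.map (fun w : Space => ‖w‖) = ν₂.map (fun w : Space => ‖w‖) := by
  have hpre : ∀ a : ℝ, (fun w : Space => ‖w‖) ⁻¹' Iio a = ball 0 a := fun a => by
    ext w
    simp
  refine Measure.ext_of_generateFrom_of_iUnion (range Iio) (fun n : ℕ => Iio (n : ℝ))
    (BorelSpace.measurable_eq.trans (borel_eq_generateFrom_Iio ℝ)) isPiSystem_Iio ?_
    (fun n => ⟨n, rfl⟩) (fun n => ?_) ?_
  · refine eq_univ_of_forall fun r => mem_iUnion.2 ?_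
    obtain ⟨n, hn⟩ := exists_nat_gt r
    exact ⟨n, hn⟩
  · rw [Measure.map_apply measurable_norm measurableSet_Iio, hpre]
    exact hfin n
  · rintro _ ⟨a, rfl⟩
    rw [Measure.map_apply measurable_norm measurableSet_Iio,
      Measure.map_apply measurable_norm measurableSet_Iio, hpre, h a]

/-- **Newton's shell theorem for a good centre.** If `x ≠ 0` satisfies the interior identity
for all rational shells beyond `‖x‖`, then for every measurable `g : ℝ → [0, ∞]`,
`∫ g(‖w‖) ‖w − x‖⁻¹ dw = ∫ g(‖w‖) (max(‖w‖, ‖x‖))⁻¹ dw ≤ ∫ g(‖w‖) ‖w‖⁻¹ dw` (the two potential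
measures have the same radial marginal, `map_norm_eq_of_forall_ball`, and
`(max(‖w‖, ‖x‖))⁻¹ ≤ ‖w‖⁻¹` off the origin). [folklore] -/
theorem lintegral_radial_mul_inv_norm_sub_le_of_shell {x : Space} (hx : x ≠ 0)
    (hgood : ∀ q r : ℚ, ‖x‖ < q →
      ∫⁻ w in (fun w : Space => ‖w‖) ⁻¹' Ioo (q : ℝ) r, ENNReal.ofReal ‖w - x‖⁻¹ =
        ∫⁻ w in (fun w : Space => ‖w‖) ⁻¹' Ioo (q : ℝ) r, ENNReal.ofReal ‖w‖⁻¹)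
    (g : ℝ → ℝ≥0∞) (hg : Measurable g) :
    ∫⁻ w : Space, g ‖w‖ * ENNReal.ofReal (‖w - x‖⁻¹) ≤
      ∫⁻ w : Space, g ‖w‖ * ENNReal.ofReal (‖w‖⁻¹) := by
  have hs : 0 < ‖x‖ := norm_pos_iff.2 hx
  have hf₁ : Measurable fun w : Space => ENNReal.ofReal ‖w - x‖⁻¹ :=
    ((measurable_id.sub_const x).norm.inv).ennreal_ofReal
  have hf₂ : Measurable fun w : Space => ENNReal.ofReal (max ‖w‖ ‖x‖)⁻¹ :=
    ((measurable_norm.max measurable_const).inv).ennreal_ofReal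
  -- the second potential measure is finite on balls
  have hfin : ∀ n : ℕ, (volume.withDensity fun w : Space => ENNReal.ofReal (max ‖w‖ ‖x‖)⁻¹)
      (ball 0 n) ≠ ∞ := fun n => by
    rw [withDensity_apply _ measurableSet_ball]
    refine ne_top_of_le_ne_top ?_ (setLIntegral_mono measurable_const fun w _ =>
      ENNReal.ofReal_le_ofReal (inv_anti₀ hs (le_max_right ‖w‖ ‖x‖)))
    rw [setLIntegral_const]
    exact ENNReal.mul_ne_top ENNReal.ofReal_ne_top measure_ball_lt_top.ne
  have hmap := map_norm_eq_of_forall_ball hfin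
    fun a => (withDensity_inv_norm_sub_ball hgood a).symm
  -- rewrite both integrals through the radial marginals
  have h1 : ∫⁻ w : Space, g ‖w‖ * ENNReal.ofReal ‖w - x‖⁻¹ =
      ∫⁻ r, g r ∂((volume.withDensity fun w : Space => ENNReal.ofReal ‖w - x‖⁻¹).map
        fun w : Space => ‖w‖) := by
    rw [lintegral_map hg measurable_norm, lintegral_withDensity_eq_lintegral_mul _ hf₁
      (show Measurable fun w : Space => g ‖w‖ from hg.comp measurable_norm)]
    exact lintegral_congr fun w => by simp only [Pi.mul_apply, mul_comm]
  have h2 : ∫⁻ w : Space, g ‖w‖ * ENNReal.ofReal (max ‖w‖ ‖x‖)⁻¹ =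
      ∫⁻ r, g r ∂((volume.withDensity fun w : Space => ENNReal.ofReal (max ‖w‖ ‖x‖)⁻¹).map
        fun w : Space => ‖w‖) := by
    rw [lintegral_map hg measurable_norm, lintegral_withDensity_eq_lintegral_mul _ hf₂
      (show Measurable fun w : Space => g ‖w‖ from hg.comp measurable_norm)]
    exact lintegral_congr fun w => by simp only [Pi.mul_apply, mul_comm]
  rw [h1, ← hmap, ← h2]
  -- pointwise comparison off the origin
  have hae : ∀ᵐ w : Space, w ≠ 0 := by
    rw [ae_iff]
    simp only [not_not, setOf_eq_eq_singleton]
    exact measure_singleton 0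
  refine lintegral_mono_ae ?_
  filter_upwards [hae] with w hw
  exact mul_le_mul' le_rfl (ENNReal.ofReal_le_ofReal
    (inv_anti₀ (norm_pos_iff.2 hw) (le_max_left ‖w‖ ‖x‖)))

/-! ### (S7) The Newtonian potential of a radial charge is maximal at the centre -/

/-- **(S7)** For a radial density `g(|w|) ≥ 0` on `ℝ³`, `∫ g(|w|)/|w − x| dw ≤ ∫ g(|w|)/|w| dw` for
a.e. `x` (Newton's shell theorem: the potential of a spherical shell is `mass/max(r, |x|)`).
Here: for a.e. `x`, the interior identity holds for all rational shells beyond `|x|`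
(`shellPotential_ae_eq`, countably many null sets), and then
`lintegral_radial_mul_inv_norm_sub_le_of_shell` applies (`x = 0` being trivial).
[folklore] -/
theorem stub_lintegral_radial_mul_inv_norm_sub_le (g : ℝ → ℝ≥0∞) (hg : Measurable g) :
    ∀ᵐ x : Space, ∫⁻ w : Space, g ‖w‖ * ENNReal.ofReal (‖w - x‖⁻¹) ≤
      ∫⁻ w : Space, g ‖w‖ * ENNReal.ofReal (‖w‖⁻¹) := by
  have hgood : ∀ᵐ x : Space, ∀ q r : ℚ, ‖x‖ < q →
      ∫⁻ w in (fun w : Space => ‖w‖) ⁻¹' Ioo (q : ℝ) r, ENNReal.ofReal ‖w - x‖⁻¹ =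
        ∫⁻ w in (fun w : Space => ‖w‖) ⁻¹' Ioo (q : ℝ) r, ENNReal.ofReal ‖w‖⁻¹ := by
    refine ae_all_iff.2 fun q => ae_all_iff.2 fun r => ?_
    rcases le_or_gt (q : ℝ) 0 with hq0 | hq0
    · exact Eventually.of_forall fun x hx => absurd (hx.trans_le hq0) (not_lt.2 (norm_nonneg x))
    · exact shellPotential_ae_eq hq0
  filter_upwards [hgood] with x hx
  rcases eq_or_ne x 0 with rfl | hx0
  · simp only [sub_zero, le_refl]
  · exact lintegral_radial_mul_inv_norm_sub_le_of_shell hx0 hx g hg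

end Summit.AtomisticToContinuum.BoseEinsteinCondensation.Theorems.CutLineWitness

end
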